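import Summits.BirchSwinnertonDyer.BirchSwinnertonDyer.Theorems.CongruentShaFreeCutKatoDescentDatumOfH2
import Literature.NumberTheory.EllipticCurves.Kato2004.IwasawaH2DescentRankOne
import HarnessLib

set_option linter.dupNamespace false
set_option autoImplicit false

/-! # Reading (3.1′) of the Kato–zeta road ON A v2-PINNED DATUM is bsd-cn100-ty's named fact
# `Kato2004.finite_descentCokernel_of_rankOne` transported along the pin: `rank W(ℚ) = 1 ∧ #Ш(W)[p^∞] < ∞ ⟹
# D.H2/T·D.H2` finite, for EVERY `W`, EVERY `p`, EVERY `D` with a pin `KatoDescentDatumPinH2 W p D`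

Cell `bsd-cn100`, prover seat `bsd-cn100-s2b-c3` (g6). THEOREMS ONLY (no definition, no named fact, no
instance); `W`- and `p`-generic plumbing shared by the two Kato–zeta / Perrin-Riou roads of the cell — route
`CongruentShaFreeCut` crux B (stmt-BirchSwinnertonDyer-19080, `(E_n, 2)`,
`Theorems/CongruentShaFreeCutKatoZetaRoadPinnedH2.lean` p465073) and route `MordellShaFreeCut` crux B
(stmt-BirchSwinnertonDyer-19160, `(W, 3)` with `j(W) = 0`, `Theorems/MordellShaFreeCutKatoZetaRoadPinnedH2.lean`) —
whose displayed hypothesis (3.1′) `h31` reads «`Nonempty (KatoDescentDatumPinH2 W p D) → rank W(ℚ) = 1 →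
Finite Ш(W)[p^∞] → Finite (coinvariants p D.H2)`». bsd-cn100-ty (g7, p464597,
`Literature/…/Kato2004/IwasawaH2DescentRankOne.lean`) typed Kato's (14.9.3) + (14.14.1)–(14.14.2) in the
rank-one `Ш[p^∞]`-finite case as ONE named fact on PINNED objects, `Kato2004.finite_descentCokernel_of_rankOne`
(«`H¹(ℤ[1/p], T_pW) / proj₀(𝐇¹_Γ/T)` is finite»), and proved its transport to every descent package
(`IwasawaH2Data.finite_coinvariants_H2_of_rankOne`). This file carries it the last step, along the v2 pin's
`eH2 : D.H2 ≃ₗ[Λ] J.H2` (`IwasawaAlgebra.coinvariantsEquiv`), to the abstract datum `D` the roads quantify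
over — so a registered stub `stub_reading31 : Kato2004.finite_descentCokernel_of_rankOne` (a Literature fact BY
NAME, citation-borne, token-identical on both items) discharges (3.1′) on both roads. Dot-notation extensions of
`KatoDescentDatumPinH2` (seat `bsd-cn100-s2-c3`'s structure, p464529) declared HERE so that the accepted hub is
not re-filed (farm hygiene 2026-08-26T18:33:46Z). Imports the v2 pin and Literature only — NO `Theses` module
(build rule 2026-08-26T19:10:10Z / (H)). HONEST FRAMING: plumbing; conditional on the displayed named fact where
it appears; nothing about crux B of either route, the congruent number problem, Sylvester's problem or BSD is
proved. PARTITION: none — RANK axis.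

References: K. Kato, Astérisque 295 (2004), §14.14 (14.14.1)–(14.14.2) (p. 243), (14.9.3) (p. 240)
[Kato2004Asterisque]; Burungale–Skinner, App. A to arXiv:2210.10730, §10.1.3 (p. 34) [AlpogeBhargavaShnidman2022].
-/

noncomputable section

open scoped Classical

namespace Summit.BirchSwinnertonDyer.BirchSwinnertonDyer.Theorems.CongruentShaFreeCutKatoDescentDatumOfH2

open WeierstrassCurve Field Literature.NumberTheory.EllipticCurves
  Literature.NumberTheory.EllipticCurves.Kato2004 Literature.NumberTheory.EllipticCurves.IwasawaAlgebra
  Literature.NumberTheory.EllipticCurves.Kato2004.EulerSystemValues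
  Literature.NumberTheory.GaloisRepresentations
open Summit.BirchSwinnertonDyer.Rank1Residual.Additive (KatoDescentDatum)

namespace KatoDescentDatumPinH2

variable {W : WeierstrassCurve ℚ} [W.IsElliptic] {p : ℕ} [Fact p.Prime]
  [ContinuousSMul ℤ_[p] (W.tateModule p)] {D : KatoDescentDatum p}

/-- **`D.H2/T·D.H2` is finite iff `𝐇²_Γ/T·𝐇²_Γ` (the package's) is** — transport of the `Γ`-coinvariants
along the pin `eH2 : D.H2 ≃ₗ[Λ] J.H2` (`IwasawaAlgebra.coinvariantsEquiv`). [folklore] -/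
theorem finite_coinvariants_H2_iff (P : KatoDescentDatumPinH2 W p D) :
    Finite (coinvariants p D.H2) ↔ Finite (coinvariants p P.J.H2) :=
  ⟨fun _ ↦ Finite.of_equiv _ (coinvariantsEquiv P.eH2).toEquiv,
    fun _ ↦ Finite.of_equiv _ (coinvariantsEquiv P.eH2).symm.toEquiv⟩

/-- **`D.H2/T·D.H2` is finite iff the PINNED descent cokernel `H¹(ℤ[1/p], T_pW) / proj₀(𝐇¹_Γ/T)` is** —
Kato's (14.14.1) on the package (`IwasawaH2Data.finite_descentCokernel_iff_finite_coinvariants_H2`: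
`descentCokernel ≃ 𝐇²_Γ[T]`, and `𝐇²[T]` finite `↔` `𝐇²/T` finite for the finitely generated torsion
`𝐇²`) composed with `finite_coinvariants_H2_iff`. [cite: Kato2004Asterisque, §14.14 (14.14.1)–(14.14.2) (p. 243)] -/
theorem finite_coinvariants_H2_iff_finite_descentCokernel (P : KatoDescentDatumPinH2 W p D) :
    Finite (coinvariants p D.H2) ↔ Finite (IwasawaH1Data.descentCokernel P.I) := by
  rw [P.finite_coinvariants_H2_iff, P.J.finite_descentCokernel_iff_finite_coinvariants_H2]

/-- **Reading (3.1′) on a v2-pinned datum from the named fact** `Kato2004.finite_descentCokernel_of_rankOne`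
(Kato (14.9.3) + (14.14.1)–(14.14.2), rank-one `Ш[p^∞]`-finite case, pinned objects): `rank W(ℚ) = 1 ∧
#Ш(W)[p^∞] < ∞ ⟹ D.H2/T·D.H2` finite. Proof: ty's `IwasawaH2Data.finite_coinvariants_H2_of_rankOne` on the
package `P.J` (cyclotomic `P.κ`, generator `P.γ`), transported by `finite_coinvariants_H2_iff`. CONDITIONAL on
the displayed fact; credits nothing. [cite: Kato2004Asterisque, (14.9.3) (p. 240) and §14.14 (14.14.1)–(14.14.2) (p. 243)]
[cite: AlpogeBhargavaShnidman2022, App. A §10.1.3 (p. 34) (printed instance)] -/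
theorem finite_coinvariants_H2_of_rankOne (P : KatoDescentDatumPinH2 W p D)
    (h : finite_descentCokernel_of_rankOne) (hrank : W.mordellWeilRank = 1)
    (hsha : Finite (AddCommGroup.primaryComponent W.sha p)) :
    Finite (coinvariants p D.H2) :=
  P.finite_coinvariants_H2_iff.mpr
    (P.J.finite_coinvariants_H2_of_rankOne h P.isCyclotomic P.isTopGenerator hrank hsha)

end KatoDescentDatumPinH2

/-! ## The roads' binder shape: `Nonempty (KatoDescentDatumPinH2 W p D) → …` -/

section Schema

variable {W : WeierstrassCurve ℚ} [W.IsElliptic] {p : ℕ} [Fact p.Prime]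
  [ContinuousSMul ℤ_[p] (W.tateModule p)]

/-- **Reading (3.1′) in the roads' displayed shape, for every `W` and `p`, from the named fact**: granted
`Kato2004.finite_descentCokernel_of_rankOne`, every abstract datum `D` that ADMITS a v2 pin has
`D.H2/T·D.H2` finite as soon as `rank W(ℚ) = 1` and `Ш(W)[p^∞]` is finite — the hypothesis schema `h31` of
`CongruentShaFreeCutKatoZetaRoadPinnedH2.cruxB_of_prFormulaH2_of_readings` (at `(E_n, 2)`) and of its S2b twin
(at `(W, 3)`, `j(W) = 0`) with the curve-specific outer binders stripped. CONDITIONAL on the displayed fact;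
credits nothing. [cite: Kato2004Asterisque, (14.9.3) (p. 240) and §14.14 (14.14.1)–(14.14.2) (p. 243)]
[cite: AlpogeBhargavaShnidman2022, App. A §10.1.3 (p. 34)] -/
theorem finite_coinvariants_H2_of_rankOne_of_nonempty_pinH2 (h : finite_descentCokernel_of_rankOne)
    (D : KatoDescentDatum p) (hD : Nonempty (KatoDescentDatumPinH2 W p D))
    (hrank : W.mordellWeilRank = 1) (hsha : Finite (AddCommGroup.primaryComponent W.sha p)) :
    Finite (coinvariants p D.H2) := by
  obtain ⟨P⟩ := hD
  exact P.finite_coinvariants_H2_of_rankOne h hrank hsha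

end Schema

section SchemaProp

variable {W : WeierstrassCurve ℚ} [W.IsElliptic] {p : ℕ} [Fact p.Prime]

/-- The same under the `Prop`-valued pin `IsKatoDescentDatumOfH2 W p D` (whose instance slot is
`TateModule.continuousSMul_padicInt`; any two instances of the `Prop`-valued structure fact agree).
[cite: Kato2004Asterisque, (14.9.3) (p. 240) and §14.14 (14.14.1)–(14.14.2) (p. 243)] -/
theorem finite_coinvariants_H2_of_rankOne_of_isKatoDescentDatumOfH2 (h : finite_descentCokernel_of_rankOne)
    (D : KatoDescentDatum p) (hD : IsKatoDescentDatumOfH2 W p D)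
    (hrank : W.mordellWeilRank = 1) (hsha : Finite (AddCommGroup.primaryComponent W.sha p)) :
    Finite (coinvariants p D.H2) := by
  letI : ContinuousSMul ℤ_[p] (W.tateModule p) := TateModule.continuousSMul_padicInt
  obtain ⟨P⟩ := hD
  exact P.finite_coinvariants_H2_of_rankOne h hrank hsha

end SchemaProp

end Summit.BirchSwinnertonDyer.BirchSwinnertonDyer.Theorems.CongruentShaFreeCutKatoDescentDatumOfH2

end
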